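import Summits.CriticalPhenomena.PercolationContinuityZ3.Theorems.PercNearOneGluingNoHeavyLowerTailCertFast
import Literature.Probability.Percolation.TwoClusterExchange
import HarnessLib

/-!
# `NoHeavyLowerTail` (stmt-CriticalPhenomena-4575) — certificate machine, part 7:
# more row families as data — two-cluster exchange (`tc`, BHK Thm 1.5) and negative correlation (`nc`, KN Lemma 1(ii))

Support file (depth prover nh-dp-blobmono gen 3; `--supports stmt-CriticalPhenomena-4575`).  Computable definitions +
soundness; no named facts, no sorries, standard axioms.

Parts 2–6 replay certificates whose rows are `terminalSeparation_general` (`ts`) and `RowLemmas.kn_chain` (`kn`).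
The certificate searches of the other seats (prim-cplus-coupling's "BHK products", gen-2's degree-2 constant scans)
also use the TWO-CLUSTER EXCHANGE rows of `Literature.Probability.Percolation.twoClusterExchange` and the
negative-correlation rows `RowLemmas.negCorr_lits`.  This file adds them as data:

* `RowSpecX.tc s t A₁ A₂ B₁ B₂` — on `D = {s ≁ t}`, with `A`-literals (`(u, true)` = `s ~ u`, `(u, false)` = `t ≁ u`,
  type `(+)`) and `B`-literals (`(u, true)` = `t ~ u`, `(u, false)` = `s ≁ u`, type `(−)`):
  `μ(D A₁ B₁) μ(D A₂ B₂) ≤ μ(D A₁ A₂) μ(D B₁ B₂)` (no side condition: for `v s = v t` both sides vanish);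
* `RowSpecX.nc x T O Lp` — `μ(D) μ(E D Q⁺) ≤ μ(E D) μ(D Q⁺)`, `E = {x ~ O}`, `D = {x ≁ T}`, `Q⁺ = {t ~ u, (t,u) ∈ Lp}`
  (side condition: first components of `Lp` in `T`);
* `RowSpecX.holds`; `CertX` = a `Cert` body plus extra rows, with `CertX.checkCBf` (fast bucketed check with
  constant) and THE WRAPPER `CertX.existsC_le_of_injective` (same statement and proof pattern as part 5).
-/

noncomputable section

namespace Summit.CriticalPhenomena.PercolationContinuityZ3.Theorems

open MeasureTheory Set Filter Literature.Probability.Percolation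
open Literature.Probability.LatticeModels (prodBernoulli)
open scoped Classical BigOperators Topology
open PatternCells CertCheck

namespace CertCells

variable {n : ℕ}

/-- The extra row families. [folklore] -/
inductive RowSpecX where
  /-- two-cluster exchange row (BHK 2006 Thm 1.5, event form) -/
  | tc (s t : Fin 5) (A₁ A₂ B₁ B₂ : List (Fin 5 × Bool)) (mult : List ℕ) (wt : ℕ)
  /-- negative-correlation row (KN Lemma 1(ii) with literal guards) -/
  | nc (x : Fin 5) (T O : List (Fin 5)) (Lp : List (Fin 5 × Fin 5)) (mult : List ℕ) (wt : ℕ)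
  deriving Repr

/-- An `A`-literal of the pair `(s,t)` as a terminal literal: `(u,true) ↦ s ~ u`, `(u,false) ↦ t ≁ u`. [folklore] -/
def aLit (s t : Fin 5) (l : Fin 5 × Bool) : Lit := if l.2 then (s, l.1, true) else (t, l.1, false)

/-- A `B`-literal of the pair `(s,t)` as a terminal literal: `(u,true) ↦ t ~ u`, `(u,false) ↦ s ≁ u`. [folklore] -/
def bLit (s t : Fin 5) (l : Fin 5 × Bool) : Lit := if l.2 then (t, l.1, true) else (s, l.1, false)

/-- Side conditions. [folklore] -/
def RowSpecX.valid : RowSpecX → Bool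
  | .tc .. => true
  | .nc _ T _ Lp _ _ => Lp.all fun p => decide (p.1 ∈ T)

/-- The four one-clause events `E₁, E₂, E₃, E₄` (row reads `μE₁ μE₂ ≤ μE₃ μE₄`). [folklore] -/
def RowSpecX.clauses : RowSpecX → List Lit × List Lit × List Lit × List Lit
  | .tc s t A₁ A₂ B₁ B₂ _ _ =>
    ((s, t, false) :: (A₁.map (aLit s t) ++ B₁.map (bLit s t)),
      (s, t, false) :: (A₂.map (aLit s t) ++ B₂.map (bLit s t)),
      (s, t, false) :: (A₁.map (aLit s t) ++ A₂.map (aLit s t)),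
      (s, t, false) :: (B₁.map (bLit s t) ++ B₂.map (bLit s t)))
  | .nc x T O Lp _ _ =>
    (litsSep x T, litsConn x O ++ (litsSep x T ++ litsPairs Lp true), litsConn x O ++ litsSep x T,
      litsSep x T ++ litsPairs Lp true)

/-- Multiplier. [folklore] -/
def RowSpecX.mult : RowSpecX → List ℕ
  | .tc _ _ _ _ _ _ m _ => m
  | .nc _ _ _ _ m _ => m

/-- Weight. [folklore] -/
def RowSpecX.wt : RowSpecX → ℕ
  | .tc _ _ _ _ _ _ _ w => w
  | .nc _ _ _ _ _ w => w

/-- The algebraic row. [folklore] -/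
def RowSpecX.toRow (r : RowSpecX) : Row :=
  ⟨cellsOf [r.clauses.1], cellsOf [r.clauses.2.1], cellsOf [r.clauses.2.2.1], cellsOf [r.clauses.2.2.2],
    r.mult, r.wt⟩

/-! ### Types of the literal events -/

/-- The event of a list of `A`-literals. [folklore] -/
def setA (v : Fin 5 → Fin n) (s t : Fin 5) (A : List (Fin 5 × Bool)) : Set (BondConfig (Fin n)) :=
  {ω | ∀ l ∈ A, Lit.holds v (aLit s t l) ω}

/-- The event of a list of `B`-literals. [folklore] -/
def setB (v : Fin 5 → Fin n) (s t : Fin 5) (B : List (Fin 5 × Bool)) : Set (BondConfig (Fin n)) :=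
  {ω | ∀ l ∈ B, Lit.holds v (bLit s t l) ω}

/-- `A`-literal events are of type `(+)` for the pair `(v s, v t)`. [folklore] -/
theorem setA_closed (v : Fin 5 → Fin n) (s t : Fin 5) (A : List (Fin 5 × Bool)) ⦃ω ω' : BondConfig (Fin n)⦄
    (hs : openEdgeCluster ω (v s) ⊆ openEdgeCluster ω' (v s))
    (ht : openEdgeCluster ω' (v t) ⊆ openEdgeCluster ω (v t)) (h : ω ∈ setA v s t A) : ω' ∈ setA v s t A := by
  intro l hl
  have hω := h l hl
  obtain ⟨u, k⟩ := l
  cases k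
  · simp only [aLit, Bool.false_eq_true, ↓reduceIte, holds_false] at hω ⊢
    exact typePlus_not_openConn (v s) (v t) (v u) hs ht hω
  · simp only [aLit, ↓reduceIte, holds_true] at hω ⊢
    exact typePlus_openConn (v s) (v t) (v u) hs ht hω

/-- `B`-literal events are of type `(−)` for the pair `(v s, v t)`. [folklore] -/
theorem setB_closed (v : Fin 5 → Fin n) (s t : Fin 5) (B : List (Fin 5 × Bool)) ⦃ω ω' : BondConfig (Fin n)⦄
    (hs : openEdgeCluster ω' (v s) ⊆ openEdgeCluster ω (v s))
    (ht : openEdgeCluster ω (v t) ⊆ openEdgeCluster ω' (v t)) (h : ω ∈ setB v s t B) : ω' ∈ setB v s t B := by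
  intro l hl
  have hω := h l hl
  obtain ⟨u, k⟩ := l
  cases k
  · simp only [bLit, Bool.false_eq_true, ↓reduceIte, holds_false] at hω ⊢
    exact typeMinus_not_openConn (v s) (v t) (v u) hs ht hω
  · simp only [bLit, ↓reduceIte, holds_true] at hω ⊢
    exact typeMinus_openConn (v s) (v t) (v u) hs ht hω

/-- The one-clause event `D :: (X ++ Y)` is `{s ≁ t} ∩ (X-event ∩ Y-event)`. [folklore] -/
theorem set_tcClause (v : Fin 5 → Fin n) (s t : Fin 5) (X Y : List Lit) :
    Formula.set v [(s, t, false) :: (X ++ Y)] =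
      (openConn (v s) (v t) : Set (BondConfig (Fin n)))ᶜ ∩
        ({ω | ∀ l ∈ X, Lit.holds v l ω} ∩ {ω | ∀ l ∈ Y, Lit.holds v l ω}) := by
  ext ω
  rw [mem_set_single, List.forall_mem_cons, List.forall_mem_append, holds_false]
  rfl

/-- **Extra row specs are valid rows**, for every weighted graph and every placement `v`.
[cite: VandenbergHaggstromKahn2005, Thm. 1.5 (p. 7); KozmaNitzan2024, Lemma 1(ii) (p. 5)] -/
theorem RowSpecX.holds (r : RowSpecX) (hr : r.valid = true) (w : Sym2 (Fin n) → unitInterval)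
    (v : Fin 5 → Fin n) :
    linEval (fun m => (prodBernoulli w).real (Cell v m)) r.toRow.e1 *
        linEval (fun m => (prodBernoulli w).real (Cell v m)) r.toRow.e2 ≤
      linEval (fun m => (prodBernoulli w).real (Cell v m)) r.toRow.e3 *
        linEval (fun m => (prodBernoulli w).real (Cell v m)) r.toRow.e4 := by
  cases r with
  | tc s t A₁ A₂ B₁ B₂ mult wt =>
    simp only [RowSpecX.toRow, RowSpecX.clauses, ← measureReal_set_eq_linEval]
    have eA : ∀ A : List (Fin 5 × Bool), {ω : BondConfig (Fin n) | ∀ l ∈ A.map (aLit s t), Lit.holds v l ω} =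
        setA v s t A := fun A => by
      ext ω; simp only [mem_setOf_eq, List.forall_mem_map, setA]
    have eB : ∀ B : List (Fin 5 × Bool), {ω : BondConfig (Fin n) | ∀ l ∈ B.map (bLit s t), Lit.holds v l ω} =
        setB v s t B := fun B => by
      ext ω; simp only [mem_setOf_eq, List.forall_mem_map, setB]
    rw [set_tcClause, set_tcClause, set_tcClause, set_tcClause, eA, eA, eB, eB]
    by_cases hst : v s = v t
    · have hD : (openConn (v s) (v t) : Set (BondConfig (Fin n)))ᶜ = ∅ := by
        ext ω
        simp only [mem_compl_iff, mem_empty_iff_false, iff_false, not_not, hst]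
        exact SimpleGraph.Reachable.refl _
      simp [hD]
    · exact twoClusterExchange w hst (setA_closed v s t A₁) (setA_closed v s t A₂) (setB_closed v s t B₁)
        (setB_closed v s t B₂)
  | nc x T O Lp mult wt =>
    simp only [RowSpecX.toRow, RowSpecX.clauses, ← measureReal_set_eq_linEval]
    have key := RowLemmas.negCorr_lits w (v x) (T.map v).toFinset (O.map v).toFinset
      ((Lp.map fun p => (v p.1, v p.2)).toFinset) (fst_mem_image v hr)
    have e1 : Formula.set v [litsSep x T] = {ω | ∀ t ∈ (T.map v).toFinset, ω ∉ openConn (v x) t} := by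
      ext ω
      rw [mem_set_single, forall_litsSep]
      rfl
    have e2 : Formula.set v [litsConn x O ++ (litsSep x T ++ litsPairs Lp true)] =
        {ω | ∀ u ∈ (O.map v).toFinset, ω ∈ openConn (v x) u} ∩
          {ω | ∀ t ∈ (T.map v).toFinset, ω ∉ openConn (v x) t} ∩
            {ω | ∀ p ∈ (Lp.map fun p => (v p.1, v p.2)).toFinset, ω ∈ openConn p.1 p.2} := by
      ext ω
      rw [mem_set_single, List.forall_mem_append, List.forall_mem_append, forall_litsConn, forall_litsSep,
        forall_litsPairs_true, Set.mem_inter_iff, Set.mem_inter_iff]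
      simp only [mem_setOf_eq]
      tauto
    have e3 : Formula.set v [litsConn x O ++ litsSep x T] =
        {ω | ∀ u ∈ (O.map v).toFinset, ω ∈ openConn (v x) u} ∩
          {ω | ∀ t ∈ (T.map v).toFinset, ω ∉ openConn (v x) t} := by
      ext ω
      rw [mem_set_single, List.forall_mem_append, forall_litsConn, forall_litsSep]
      rfl
    have e4 : Formula.set v [litsSep x T ++ litsPairs Lp true] =
        {ω | ∀ t ∈ (T.map v).toFinset, ω ∉ openConn (v x) t} ∩
          {ω | ∀ p ∈ (Lp.map fun p => (v p.1, v p.2)).toFinset, ω ∈ openConn p.1 p.2} := by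
      ext ω
      rw [mem_set_single, List.forall_mem_append, forall_litsSep, forall_litsPairs_true]
      rfl
    rw [e1, e2, e3, e4]
    exact key

/-- Permute an extra row spec (for folded certificates). [folklore] -/
def RowSpecX.permute (σ : Fin 5 → Fin 5) : RowSpecX → RowSpecX
  | .tc s t A₁ A₂ B₁ B₂ m w =>
    .tc (σ s) (σ t) (A₁.map fun l => (σ l.1, l.2)) (A₂.map fun l => (σ l.1, l.2)) (B₁.map fun l => (σ l.1, l.2))
      (B₂.map fun l => (σ l.1, l.2)) (sortMono (m.map (permPattern σ))) w
  | .nc x T O Lp m w =>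
    .nc (σ x) (T.map σ) (O.map σ) (Lp.map fun p => (σ p.1, σ p.2)) (sortMono (m.map (permPattern σ))) w

/-- Unfold extra row specs under a list of terminal permutations. [folklore] -/
def unfoldRowsX (G : List (Fin 5 → Fin 5)) (rows : List RowSpecX) : List RowSpecX :=
  rows.flatMap fun r => G.map fun σ => r.permute σ

/-! ## Certificates with extra rows -/

/-- A certificate with `ts`/`kn` rows and extra `tc`/`nc` rows. [folklore] -/
structure CertX where
  /-- the target event -/
  L : Formula
  /-- the reference events -/
  U : List Formula
  /-- `ts`/`kn` rows -/
  rows : List RowSpec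
  /-- `tc`/`nc` rows -/
  rowsX : List RowSpecX
  /-- multiplier terms -/
  al : List ATerm

/-- All rows satisfy their side conditions. [folklore] -/
def CertX.rowsValid (C : CertX) : Bool := C.rows.all RowSpec.valid && C.rowsX.all RowSpecX.valid

/-- Cells of the reference event number `ref`. [folklore] -/
def CertX.Ucells (C : CertX) (ref : ℕ) : List ℕ := cellsOf (C.U.getD ref [])

/-- All algebraic rows. [folklore] -/
def CertX.allRows (C : CertX) : List Row := C.rows.map RowSpec.toRow ++ C.rowsX.map RowSpecX.toRow

/-- A multiplier term with positive weight on consistent cells. [folklore] -/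
def CertX.posTerm (C : CertX) : Bool :=
  C.al.any fun a => decide (0 < a.wt) && a.mult.all fun c => decide (c ∈ consPatterns)

/-- The bucketed check with constant `p/q`. [folklore] -/
def CertX.checkCB (C : CertX) (p q nb b : ℕ) : Bool :=
  CertCheck.checkCB p q nb b (cellsOf C.L) C.Ucells C.allRows C.al

/-- The fast bucketed check with constant `p/q`. [folklore] -/
def CertX.checkCBf (C : CertX) (p q nb b : ℕ) : Bool :=
  CertCheck.checkCBf p q nb b (cellsOf C.L) C.Ucells C.allRows C.al

/-- The fast check is the check. [folklore] -/
theorem CertX.checkCB_of_checkCBf (C : CertX) (p q nb : ℕ) (h : ∀ b < nb, C.checkCBf p q nb b = true) :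
    ∀ b < nb, C.checkCB p q nb b = true := fun b hb => by
  unfold CertX.checkCB; rw [← CertCheck.checkCBf_eq]; exact h b hb

/-- All rows of a valid `CertX` hold at the cell law. [folklore] -/
theorem CertX.allRows_holds (C : CertX) (hvalid : C.rowsValid = true) (w : Sym2 (Fin n) → unitInterval)
    (v : Fin 5 → Fin n) :
    ∀ r ∈ C.allRows, linEval (fun m => (prodBernoulli w).real (Cell v m)) r.e1 *
        linEval (fun m => (prodBernoulli w).real (Cell v m)) r.e2 ≤
      linEval (fun m => (prodBernoulli w).real (Cell v m)) r.e3 *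
        linEval (fun m => (prodBernoulli w).real (Cell v m)) r.e4 := by
  unfold CertX.rowsValid at hvalid
  rw [Bool.and_eq_true, List.all_eq_true, List.all_eq_true] at hvalid
  intro r hr
  unfold CertX.allRows at hr
  rcases List.mem_append.1 hr with h | h
  · obtain ⟨s, hs, rfl⟩ := List.mem_map.1 h
    exact RowSpec.holds s (hvalid.1 s hs) w v
  · obtain ⟨s, hs, rfl⟩ := List.mem_map.1 h
    exact RowSpecX.holds s (hvalid.2 s hs) w v

/-- Measure-level soundness with constant, for `CertX`. [folklore] -/
theorem CertX.existsC_le (C : CertX) (hvalid : C.rowsValid = true) (p q : ℕ) {nb : ℕ} (hnb : 0 < nb)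
    (hcheck : ∀ b < nb, C.checkCB p q nb b = true) (w : Sym2 (Fin n) → unitInterval) (v : Fin 5 → Fin n)
    (hpos : ∃ a ∈ C.al, 0 < (a.wt : ℝ) * evalM (fun m => (prodBernoulli w).real (Cell v m)) a.mult) :
    ∃ a ∈ C.al, (q : ℝ) * (prodBernoulli w).real (C.L.set v) ≤
      (p : ℝ) * (prodBernoulli w).real ((C.U.getD a.ref []).set v) := by
  have hx : ∀ i, 0 ≤ (fun m => (prodBernoulli w).real (Cell v m)) i := fun _ => measureReal_nonneg
  have hs := soundC_of_buckets (fun m => (prodBernoulli w).real (Cell v m)) hx (cellsOf C.L) C.Ucells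
    C.allRows C.al p q hnb (C.allRows_holds hvalid w v) hcheck
  have := existsC_le_of_sound (fun m => (prodBernoulli w).real (Cell v m)) hx (cellsOf C.L) C.Ucells C.al p q
    hs hpos
  simpa [CertX.Ucells, measureReal_set_eq_linEval] using this

/-- **The certificate theorem with constant, extra row families.**  Valid rows + all buckets + a positive term
⇒ for every weighted graph and every injective placement of the five terminals, `q · μ(L) ≤ p · μ(U_{ref a})`
for some multiplier term `a`. [folklore] -/
theorem CertX.existsC_le_of_injective (C : CertX) (hvalid : C.rowsValid = true) (p q : ℕ) {nb : ℕ}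
    (hnb : 0 < nb) (hcheck : ∀ b < nb, C.checkCB p q nb b = true) (hterm : C.posTerm = true)
    (w : Sym2 (Fin n) → unitInterval) {v : Fin 5 → Fin n} (hv : Function.Injective v) :
    ∃ a ∈ C.al, (q : ℝ) * (prodBernoulli w).real (C.L.set v) ≤
      (p : ℝ) * (prodBernoulli w).real ((C.U.getD a.ref []).set v) := by
  obtain ⟨a₀, ha₀, hwa⟩ := List.any_eq_true.1 hterm
  rw [Bool.and_eq_true, decide_eq_true_eq, List.all_eq_true] at hwa
  obtain ⟨hwt, hmult⟩ := hwa
  have hk : ∀ k, ∃ a ∈ C.al, (q : ℝ) * (prodBernoulli (mixW w k)).real (C.L.set v) ≤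
      (p : ℝ) * (prodBernoulli (mixW w k)).real ((C.U.getD a.ref []).set v) := by
    intro k
    refine C.existsC_le hvalid p q hnb hcheck (mixW w k) v ⟨a₀, ha₀, mul_pos (by exact_mod_cast hwt) ?_⟩
    unfold evalM
    refine List.prod_pos fun y hy => ?_
    obtain ⟨c, hc, rfl⟩ := List.mem_map.1 hy
    have hc' : c ∈ consPatterns := by simpa using hmult c hc
    exact cell_pos (mixW w k) (fun e _ => mixW_pos_lt_one w k e) hv hc'
  by_contra hcon
  push Not at hcon
  have hev : ∀ a ∈ C.al.toFinset, ∀ᶠ k in atTop,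
      (p : ℝ) * (prodBernoulli (mixW w k)).real ((C.U.getD a.ref []).set v) <
        (q : ℝ) * (prodBernoulli (mixW w k)).real (C.L.set v) := by
    intro a ha
    exact ((((stub_weightContinuity n _).tendsto w).comp (tendsto_mixW w)).const_mul (p : ℝ)).eventually_lt
      ((((stub_weightContinuity n _).tendsto w).comp (tendsto_mixW w)).const_mul (q : ℝ))
      (hcon a (List.mem_toFinset.1 ha))
  obtain ⟨k, hk'⟩ := ((Finset.eventually_all _).2 hev).exists
  obtain ⟨a, ha, hle⟩ := hk k
  exact absurd hle (not_le.2 (hk' a (List.mem_toFinset.2 ha)))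

end CertCells

end Summit.CriticalPhenomena.PercolationContinuityZ3.Theorems

end
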